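import Summits.QuantumAdvantage.QuantumAdvantage.Theorems.OddPrimeWalkTripleCount

/-!
# Parallelepiped sums from coordinate-subcube parities (engine for item stmt-QuantumAdvantage-24031 `FarDegreePairLaw`)

Cell qa-qnc0, route OddPrimeWalk; prover qn-prover-3 g18 (planner qa-qnc0-p2 g29 ROUND-29 §4.5, INBOX 03:53Z check (3)).

For a frame `v : Fin D → (Fin n → Bool)` the PARTIAL SUMS `fsum v W = ⊕_{j ∈ W} v j` and the PARALLELEPIPED SUM
`ppsum f u v = Σ_{W ⊆ [D]} f(u ⊕ fsum v W)` (in `ZMod 2`).  THEOREM `ppsum_eq_zero`: if all `D`-dimensional COORDINATE subcube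
parities of `f` in the directions of a position predicate `P` vanish (exactly the filed hypothesis shape of `FarDegreePairLaw`:
`(S.powerset.filter …).card % 2 = 0` for `|S| = D`, `S ⊆ P`), then `ppsum f u v = 0` for EVERY base `u` and EVERY frame of `D`
vectors supported in `P` — the `D`-dimensional analogue of `sq_single`/`sq_zero` (file `OddPrimeWalkOddConfigAffine`).  Proof:
multilinearity in each frame vector (`ppsum_update_addV`) peels one bit at a time (strong induction on the total support); frames
with a zero vector (`ppsum_eq_zero_of_zero`) or two equal vectors (`ppsum_eq_zero_of_eq`, involution `W ↦ W ∆ {j} ∆ {j'}`) cancel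
in pairs; frames of distinct unit vectors are the filed parities (`ppsum_unit_eq_zero`).  Corollary `sum_nonempty_eq`:
`Σ_{W ≠ ∅} f(u ⊕ fsum v W) = f(u)`.
WHAT THIS IS NOT: instrument; separation NOT moved.
-/

namespace Summit.QuantumAdvantage.AdviceFreeQNC0.OddConfig

open Finset Classical
open scoped symmDiff

variable {n D : ℕ}

/-! ### §1 Frames and their partial sums -/

/-- the partial XOR-sum `⊕_{j ∈ W} v j` of a frame `v : Fin D → (Fin n → Bool)`. -/
def fsum (v : Fin D → Fin n → Bool) (W : Finset (Fin D)) : Fin n → Bool :=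
  fun i => decide ((W.filter fun j => v j i = true).card % 2 = 1)

/-- the empty partial sum is zero. -/
theorem fsum_empty (v : Fin D → Fin n → Bool) : fsum v ∅ = zeroV := by
  funext i; simp [fsum, zeroV]

/-- adding one more frame vector. -/
theorem fsum_insert (v : Fin D → Fin n → Bool) {j : Fin D} {W : Finset (Fin D)} (hj : j ∉ W) :
    fsum v (insert j W) = addV (v j) (fsum v W) := by
  funext i
  simp only [fsum, addV, filter_insert]
  by_cases h : v j i = true
  · rw [if_pos h, card_insert_of_notMem (fun h' => hj (mem_filter.mp h').1), h]
    rcases Nat.mod_two_eq_zero_or_one (W.filter fun j => v j i = true).card with h0 | h1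
    · simp [h0, Nat.add_mod]
    · simp [h1, Nat.add_mod]
  · rw [if_neg h]
    have h' : v j i = false := by simpa using h
    simp [h']

/-- removing one frame vector. -/
theorem fsum_erase (v : Fin D → Fin n → Bool) {j : Fin D} {W : Finset (Fin D)} (hj : j ∈ W) :
    fsum v (W.erase j) = addV (v j) (fsum v W) := by
  conv_rhs => rw [← insert_erase hj, fsum_insert v (notMem_erase j W)]
  rw [← addV_assoc, addV_self, addV_comm, addV_zeroV]

/-- toggling the membership of `j` adds `v j`. -/
theorem fsum_symmDiff_singleton (v : Fin D → Fin n → Bool) (j : Fin D) (W : Finset (Fin D)) :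
    fsum v (W ∆ {j}) = addV (v j) (fsum v W) := by
  by_cases hj : j ∈ W
  · have e : W ∆ {j} = W.erase j := by
      ext x; simp only [mem_symmDiff, mem_singleton, mem_erase]
      constructor
      · rintro (⟨h1, h2⟩ | ⟨h1, h2⟩)
        · exact ⟨h2, h1⟩
        · subst h1; exact absurd hj h2
      · rintro ⟨h1, h2⟩; exact Or.inl ⟨h2, h1⟩
    rw [e, fsum_erase v hj]
  · have e : W ∆ {j} = insert j W := by
      ext x; simp only [mem_symmDiff, mem_singleton, mem_insert]
      constructor
      · rintro (⟨h1, _⟩ | ⟨h1, _⟩)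
        · exact Or.inr h1
        · exact Or.inl h1
      · rintro (h1 | h1)
        · subst h1; exact Or.inr ⟨rfl, hj⟩
        · exact Or.inl ⟨h1, fun h => hj (h ▸ h1)⟩
    rw [e, fsum_insert v hj]

/-- partial sums over `W ∌ j` do not see the `j`-th frame vector. -/
theorem fsum_update_of_notMem (v : Fin D → Fin n → Bool) (j : Fin D) (x : Fin n → Bool)
    {W : Finset (Fin D)} (hj : j ∉ W) : fsum (Function.update v j x) W = fsum v W := by
  funext i
  have e : (W.filter fun j' => Function.update v j x j' i = true) = W.filter fun j' => v j' i = true :=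
    filter_congr fun j' hj' => by
      have hne : j' ≠ j := by rintro rfl; exact hj hj'
      rw [Function.update_of_ne hne]
  simp only [fsum, e]

/-! ### §2 Parallelepiped sums -/

/-- the PARALLELEPIPED SUM `Σ_{W ⊆ [D]} f(u ⊕ v_W)` in `ZMod 2`. -/
noncomputable def ppsum (f : (Fin n → Bool) → Bool) (u : Fin n → Bool) (v : Fin D → Fin n → Bool) : ZMod 2 :=
  ∑ W : Finset (Fin D), indZ (f (addV u (fsum v W)))

/-- splitting a sum over all `W` according to the membership of `j`. -/
theorem sum_finset_split (j : Fin D) (F : Finset (Fin D) → ZMod 2) :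
    (∑ W : Finset (Fin D), F W) = ∑ W ∈ (univ.erase j).powerset, (F W + F (insert j W)) := by
  rw [sum_add_distrib, ← sum_powerset_insert (notMem_erase j univ), insert_erase (mem_univ j),
    powerset_univ]

/-- membership in `(univ.erase j).powerset` means `j ∉ W`. -/
theorem notMem_of_mem_powerset_erase {j : Fin D} {W : Finset (Fin D)} (h : W ∈ (univ.erase j).powerset) :
    j ∉ W := fun hj => by
  have := mem_powerset.mp h hj
  simp at this

/-- a frame with a zero vector has vanishing parallelepiped sums. -/
theorem ppsum_eq_zero_of_zero (f : (Fin n → Bool) → Bool) (u : Fin n → Bool) (v : Fin D → Fin n → Bool)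
    {j : Fin D} (hj : v j = zeroV) : ppsum f u v = 0 := by
  rw [ppsum, sum_finset_split j]
  refine sum_eq_zero fun W hW => ?_
  rw [fsum_insert v (notMem_of_mem_powerset_erase hW), hj, addV_comm zeroV, addV_zeroV]
  exact CharTwo.add_self_eq_zero _

/-- **multilinearity** of the parallelepiped sum in the `j`-th frame vector. -/
theorem ppsum_update_addV (f : (Fin n → Bool) → Bool) (u : Fin n → Bool) (v : Fin D → Fin n → Bool)
    (j : Fin D) (a b : Fin n → Bool) :
    ppsum f u (Function.update v j (addV a b))
      = ppsum f u (Function.update v j a) + ppsum f (addV u a) (Function.update v j b) := by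
  rw [ppsum, ppsum, ppsum, sum_finset_split j, sum_finset_split j (fun W => indZ (f (addV u _))),
    sum_finset_split j (fun W => indZ (f (addV (addV u a) _))), ← sum_add_distrib]
  refine sum_congr rfl fun W hW => ?_
  have hjW := notMem_of_mem_powerset_erase hW
  simp only [fsum_insert _ hjW, fsum_update_of_notMem _ _ _ hjW, Function.update_self]
  have e1 : addV u (addV (addV a b) (fsum v W)) = addV (addV u a) (addV b (fsum v W)) := by
    rw [addV_assoc a, addV_assoc u]
  have e2 : addV (addV u a) (fsum v W) = addV u (addV a (fsum v W)) := addV_assoc u a _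
  rw [e1, e2]
  generalize indZ (f (addV u (fsum v W))) = p
  generalize indZ (f (addV u (addV a (fsum v W)))) = q
  generalize indZ (f (addV (addV u a) (addV b (fsum v W)))) = r
  have hq : q + q = 0 := CharTwo.add_self_eq_zero q
  linear_combination -hq

/-- a frame with two equal vectors has vanishing parallelepiped sums (pair `W` with `W ∆ {j} ∆ {j'}`). -/
theorem ppsum_eq_zero_of_eq (f : (Fin n → Bool) → Bool) (u : Fin n → Bool) (v : Fin D → Fin n → Bool)
    {j j' : Fin D} (hjj : j ≠ j') (h : v j = v j') : ppsum f u v = 0 := by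
  rw [ppsum]
  refine sum_ninvolution (fun W => (W ∆ {j}) ∆ {j'}) ?_ ?_ ?_ ?_
  · intro W
    have e : ∀ s : Fin n → Bool, addV (v j') (addV (v j') s) = s := fun s => by
      rw [← addV_assoc, addV_self, addV_comm, addV_zeroV]
    rw [fsum_symmDiff_singleton, fsum_symmDiff_singleton, h, e]
    exact CharTwo.add_self_eq_zero _
  · intro W _ heq
    have : j ∈ (W ∆ {j}) ∆ {j'} ↔ j ∈ W := by rw [heq]
    simp only [mem_symmDiff, mem_singleton] at this
    tauto
  · intro W; exact mem_univ _
  · intro W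
    ext x; simp only [mem_symmDiff, mem_singleton]; tauto

/-! ### §3 Unit frames: the filed coordinate-subcube parities -/

/-- flipping the bits of `u` along `T` (the form of the filed hypotheses). -/
def flipT (u : Fin n → Bool) (T : Finset (Fin n)) : Fin n → Bool := fun k => xor (u k) (decide (k ∈ T))

/-- the partial sums of a frame of DISTINCT unit vectors are indicators of image sets. -/
theorem fsum_unit (ι : Fin D ↪ Fin n) (W : Finset (Fin D)) :
    fsum (fun j => eV (ι j)) W = fun k => decide (k ∈ W.map ι) := by
  funext k
  simp only [fsum, eV, decide_eq_true_eq]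
  by_cases hk : k ∈ W.map ι
  · obtain ⟨j, hjW, hjk⟩ := mem_map.mp hk
    have e : (W.filter fun j' => k = ι j') = {j} := by
      ext j'
      simp only [mem_filter, mem_singleton]
      constructor
      · rintro ⟨_, h2⟩; exact ι.injective (h2.symm.trans hjk.symm)
      · rintro rfl; exact ⟨hjW, hjk.symm⟩
    rw [e, card_singleton]; simp [hk]
  · have e : (W.filter fun j' => k = ι j') = ∅ := by
      ext j'
      simp only [mem_filter, notMem_empty, iff_false, not_and]
      intro hj' hk'
      exact hk (mem_map.mpr ⟨j', hj', hk'.symm⟩)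
    rw [e, card_empty]; simp [hk]

/-- the parallelepiped sum of a unit frame is the subcube parity of the filed form. -/
theorem ppsum_unit (f : (Fin n → Bool) → Bool) (u : Fin n → Bool) (ι : Fin D ↪ Fin n) :
    ppsum f u (fun j => eV (ι j)) = ∑ T ∈ (univ.map ι).powerset, indZ (f (flipT u T)) := by
  rw [ppsum]
  refine sum_nbij' (fun W => W.map ι) (fun T => univ.filter fun j => ι j ∈ T) ?_ ?_ ?_ ?_ ?_
  · intro W _
    exact mem_powerset.mpr (map_subset_map.mpr (subset_univ W))
  · intro T _; exact mem_univ _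
  · intro W _
    ext j; simp
  · intro T hT
    have hT' := mem_powerset.mp (mem_coe.mp hT)
    ext k
    simp only [mem_map, mem_filter, mem_univ, true_and]
    constructor
    · rintro ⟨j, hj, rfl⟩; exact hj
    · intro hk
      obtain ⟨j, _, rfl⟩ := mem_map.mp (hT' hk)
      exact ⟨j, hk, rfl⟩
  · intro W _
    rw [fsum_unit]
    rfl

/-- the filed parity hypothesis, as the vanishing of unit parallelepiped sums. -/
theorem ppsum_unit_eq_zero (f : (Fin n → Bool) → Bool) (P : Fin n → Prop)
    (hfiled : ∀ u : Fin n → Bool, ∀ S : Finset (Fin n), S.card = D → (∀ i ∈ S, P i) →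
      (S.powerset.filter fun T => f (fun i => Bool.xor (u i) (decide (i ∈ T))) = true).card % 2 = 0)
    (u : Fin n → Bool) (ι : Fin D ↪ Fin n) (hι : ∀ j, P (ι j)) :
    ppsum f u (fun j => eV (ι j)) = 0 := by
  rw [ppsum_unit]
  have h := hfiled u (univ.map ι) (by rw [card_map, card_univ, Fintype.card_fin])
    (fun i hi => by obtain ⟨j, _, rfl⟩ := mem_map.mp hi; exact hι j)
  have hc : ((((univ.map ι).powerset.filter fun T =>
      f (fun i => Bool.xor (u i) (decide (i ∈ T))) = true).card : ℕ) : ZMod 2) = ((0 : ℕ) : ZMod 2) :=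
    (ZMod.natCast_eq_natCast_iff' _ _ 2).mpr (by rw [Nat.zero_mod]; exact h)
  rw [Nat.cast_zero, natCast_card_filter] at hc
  rw [← hc]
  refine sum_congr rfl fun T _ => ?_
  rfl

/-! ### §4 Vanishing of all parallelepiped sums along `P`-supported frames -/

/-- a vector with singleton support is a unit vector. -/
theorem eq_eV_of_suppV_eq {x : Fin n → Bool} {b : Fin n} (h : suppV x = {b}) : x = eV b := by
  funext k
  have hiff : x k = true ↔ k = b := by
    have : x k = true ↔ k ∈ suppV x := by simp [suppV]
    rw [this, h, mem_singleton]
  by_cases hk : k = b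
  · rw [hiff.mpr hk]; simp [eV, hk]
  · have hx : x k = false := by simpa using (show ¬ x k = true from fun h' => hk (hiff.mp h'))
    rw [hx]; simp [eV, hk]

/-- support of the cleared vector. -/
theorem suppV_clearBit (x : Fin n → Bool) (b : Fin n) :
    suppV (clearBit x b) = (suppV x).erase b := by
  ext k; simp only [suppV, mem_filter, mem_univ, true_and, mem_erase, clearBit, Bool.and_eq_true,
    decide_eq_true_eq]; tauto

/-- support of a unit vector. -/
theorem suppV_eV (b : Fin n) : suppV (eV b) = {b} := by
  ext k; simp [suppV, eV]

/-- the empty support means the zero vector. -/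
theorem eq_zeroV_of_suppV_eq_empty {x : Fin n → Bool} (h : suppV x = ∅) : x = zeroV := by
  funext k
  have : k ∉ suppV x := by rw [h]; exact notMem_empty k
  simp only [suppV, mem_filter, mem_univ, true_and] at this
  simpa [zeroV] using this

/-- **VANISHING OF PARALLELEPIPED SUMS.**  If all `D`-dimensional COORDINATE subcube parities of `f` in the directions of `P`
vanish (the filed form), then `Σ_{W ⊆ [D]} f(u ⊕ v_W) = 0` for every base `u` and every frame of `D` vectors supported in
`P` — multilinearity reduces to unit frames; frames with a repeated or a zero vector cancel in pairs. -/
theorem ppsum_eq_zero (f : (Fin n → Bool) → Bool) (P : Fin n → Prop)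
    (hfiled : ∀ u : Fin n → Bool, ∀ S : Finset (Fin n), S.card = D → (∀ i ∈ S, P i) →
      (S.powerset.filter fun T => f (fun i => Bool.xor (u i) (decide (i ∈ T))) = true).card % 2 = 0) :
    ∀ (N : ℕ) (u : Fin n → Bool) (v : Fin D → Fin n → Bool), (∑ j, (suppV (v j)).card) = N →
      (∀ j k, v j k = true → P k) → ppsum f u v = 0 := by
  intro N
  induction N using Nat.strong_induction_on with
  | _ N ih =>
    intro u v hN hv
    by_cases hzero : ∃ j, suppV (v j) = ∅
    · obtain ⟨j, hj⟩ := hzero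
      exact ppsum_eq_zero_of_zero f u v (eq_zeroV_of_suppV_eq_empty hj)
    push Not at hzero
    by_cases hbig : ∃ j, 2 ≤ (suppV (v j)).card
    · -- peel one bit off `v j`
      obtain ⟨j, hj⟩ := hbig
      obtain ⟨b, hb⟩ : (suppV (v j)).Nonempty := card_pos.mp (by omega)
      have hbt : v j b = true := (mem_filter.mp hb).2
      have hsplit : v j = addV (eV b) (clearBit (v j) b) := by
        rw [addV_comm]; exact eq_addV_clearBit hbt
      have hv' : v = Function.update v j (addV (eV b) (clearBit (v j) b)) := by
        rw [← hsplit, Function.update_eq_self]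
      rw [hv', ppsum_update_addV]
      have hPb : P b := hv j b hbt
      -- measures
      have hlt1 : (∑ j', (suppV (Function.update v j (eV b) j')).card) < N := by
        rw [← hN]
        refine sum_lt_sum (fun j' _ => ?_) ⟨j, mem_univ _, ?_⟩
        · by_cases h : j' = j
          · subst h; rw [Function.update_self, suppV_eV, card_singleton]; omega
          · rw [Function.update_of_ne h]
        · rw [Function.update_self, suppV_eV, card_singleton]; omega
      have hlt2 : (∑ j', (suppV (Function.update v j (clearBit (v j) b) j')).card) < N := by
        rw [← hN]
        refine sum_lt_sum (fun j' _ => ?_) ⟨j, mem_univ _, ?_⟩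
        · by_cases h : j' = j
          · subst h; rw [Function.update_self, suppV_clearBit]; exact card_le_card (erase_subset _ _)
          · rw [Function.update_of_ne h]
        · rw [Function.update_self, suppV_clearBit, card_erase_of_mem hb]; omega
      have hP1 : ∀ j' k, Function.update v j (eV b) j' k = true → P k := by
        intro j' k hk
        by_cases h : j' = j
        · subst h; rw [Function.update_self] at hk
          have : k = b := by simpa [eV] using hk
          rw [this]; exact hPb
        · rw [Function.update_of_ne h] at hk; exact hv j' k hk
      have hP2 : ∀ j' k, Function.update v j (clearBit (v j) b) j' k = true → P k := by
        intro j' k hk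
        by_cases h : j' = j
        · subst h; rw [Function.update_self] at hk
          simp only [clearBit, Bool.and_eq_true, decide_eq_true_eq] at hk
          exact hv _ k hk.1
        · rw [Function.update_of_ne h] at hk; exact hv j' k hk
      rw [ih _ hlt1 u _ rfl hP1, ih _ hlt2 (addV u (eV b)) _ rfl hP2, add_zero]
    · -- every frame vector is a unit vector
      push Not at hbig
      have hone : ∀ j, (suppV (v j)).card = 1 := by
        intro j
        have h1 := hbig j
        have h2 : 0 < (suppV (v j)).card := card_pos.mpr (hzero j)
        omega
      have hunit : ∀ j, ∃ b, suppV (v j) = {b} := fun j => card_eq_one.mp (hone j)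
      choose ι hι using hunit
      have hvι : ∀ j, v j = eV (ι j) := fun j => eq_eV_of_suppV_eq (hι j)
      by_cases hinj : Function.Injective ι
      · have hv' : v = fun j => eV ((⟨ι, hinj⟩ : Fin D ↪ Fin n) j) := by funext j; exact hvι j
        rw [hv']
        refine ppsum_unit_eq_zero f P hfiled u ⟨ι, hinj⟩ fun j => ?_
        have : v j (ι j) = true := by rw [hvι j]; simp [eV]
        exact hv j (ι j) this
      · rw [Function.Injective] at hinj
        push Not at hinj
        obtain ⟨j, j', hjj, hne⟩ := hinj
        exact ppsum_eq_zero_of_eq f u v hne (by rw [hvι j, hvι j', hjj])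

/-- the sum over the NON-EMPTY partial sums: `Σ_{W ≠ ∅} f(u ⊕ v_W) = f(u)` (in `ZMod 2`). -/
theorem sum_nonempty_eq (f : (Fin n → Bool) → Bool) (u : Fin n → Bool) (v : Fin D → Fin n → Bool)
    (h : ppsum f u v = 0) :
    (∑ W ∈ (univ : Finset (Finset (Fin D))).filter (fun W => W.Nonempty), indZ (f (addV u (fsum v W))))
      = indZ (f u) := by
  have hsplit := sum_filter_add_sum_filter_not (univ : Finset (Finset (Fin D))) (fun W => W.Nonempty)
    (fun W => indZ (f (addV u (fsum v W))))
  rw [ppsum] at h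
  rw [h] at hsplit
  have hne : (univ : Finset (Finset (Fin D))).filter (fun W => ¬ W.Nonempty) = {∅} := by
    ext W; simp [not_nonempty_iff_eq_empty]
  rw [hne, sum_singleton, fsum_empty, addV_zeroV] at hsplit
  have h2 := CharTwo.add_self_eq_zero (indZ (f u))
  linear_combination hsplit - h2

end Summit.QuantumAdvantage.AdviceFreeQNC0.OddConfig
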